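import Summits.BirchSwinnertonDyer.Rank1Residual.P2.CongruentNumberThetaThreePrimesB
import Summits.BirchSwinnertonDyer.Rank1Residual.P2.CongruentNumberThetaThreePrimesFamily
import Summits.BirchSwinnertonDyer.Rank1Residual.P2.CongruentNumberPairsAtTwoThreeSevenFamily
import HarnessLib
import HarnessLib.Audit.Tags

/-!
# Cell «bsd-monsky» (prover-B): the `k = 3` type `(3, 7, 7)` on Legendre symbols — `g(2p₁)` odd, `𝓛(p₂p₃)` even (TYZ Thm. 1.1),
# `g(n)` odd ⟺ `(p₂p₃/p₁) = −1 ∧ (p₃/p₂) = (p₂/p₁)`, `s(n) = 1` and `Σ₂′(n)` EVEN there; hence Monsky's C-P2-2 at `k = 3` on the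
# explicit SILENT family `{2p₁p₂p₃ : p₁ ≡ 3, p₂ ≡ p₃ ≡ 7 (mod 8), (p₂p₃/p₁) = −1, (p₃/p₂) = (p₂/p₁)}` relative to
# {`tyz_cmPointGaloisData`, TYZ Thm. 1.1, GZK, Monsky's even matrix theorem} (kernel theorem; nothing asserted, nothing booked)

HONEST FRAMING (cell `bsd-monsky`, run/shared/lean/pub/bsd-monsky/; README §1/§3: «ℓ ≥ 3 rungs are NOT claimed — record what the same
argument gives there»). This file completes the record for the type `(3, 7, 7)` of `P2/CongruentNumberThetaThreePrimesB.lean` (raw theorem: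
`g(n) − 𝓛(p₂p₃)·g(2p₁)` odd ⟹ `𝓛(n)` odd) by EVALUATING the coefficient with the tree's configuration calculus (finite checks by `decide`,
Rédei–Reichardt instantiated by the tree's theorem) and ONE further printed theorem taken as a named hypothesis: TYZ Thm. 1.1
(`thm11_parity_of_scriptL`, `n ≡ 1 (mod 8)`: `𝓛(p₂p₃) ≡ Σ₁(p₂p₃) = g(p₂p₃) (mod 2)`), which makes `𝓛(p₂p₃)` EVEN (`g(p₂p₃)` is even).
* §1 the configuration: residues `(3, 7, 7)`, `β = betaOf (3,7,7) (s₀, s₁, s₂)`, `s₀ = [(p₂/p₁) = −1]`, `s₁ = [(p₃/p₁) = −1]`, `s₂ = [(p₃/p₂) = −1]`;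
* §2 finite checks: Monsky kernel `2` unless `s₀ = s₁ = 1`; Rédei bits `g(n) ≡ (s₀ + s₁)(1 + s₀ + s₂)`, `g(2p₁) ≡ 1`, `g(p₂p₃) ≡ 0`; `Σ₂′ ≡ 0`
  when `(s₀ + s₁)(1 + s₀ + s₂) = 1`;
* §3 transfers to the primes; §4 THEOREM B₃ for the type (`g(n)` odd ⟹ `𝓛(n)` odd, relative to the display, a rank input and Thm. 1.1) and
  THE FAMILY THEOREMS: `ord_{s=1} L(E_n, s) = 1` relative to {`tyz_cmPointGaloisData`, Thm. 1.1}; rank `1`, `Ш[2^∞] = 0`, `BSD(E_n, 2)`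
  relative to {`tyz_cmPointGaloisData`, Thm. 1.1, GZK, `monsky_card_selmerGroup_two_even`}. The WHOLE family is silent for TYZ Thm. 1.2
  (`not_odd_genusSum₂'_two_mul_377`); census types `[3,7,7]/[1,0,1]`, `[0,1,0]` (scope-note convention), smallest members `966`, `4774`.
NOT refereed; not part of PROOF-B v1.3 or of the paper; EVIDENCE for the planner's `k = 3` decision (D-0059).

References: [TianYuanZhang2017] Thm. 1.1, Thm. 1.2, §3; [HeathBrown1994SelmerCongruentII] Appendix (Monsky) p. 41 L20–L36; [LiMa2008]
Thm. 0.4, Lemma 0.1; [IrelandRosen1990] Ch. 5 §2 Thm. 1; [Miller2011LMS] Def. 1.1; HOME/proof/PROOF-B-K3-SCOPE.md; HOME/proof/PROOF-B-K3-557.md.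
-/

noncomputable section

open scoped Classical

open Matrix Finset WeierstrassCurve Literature.NumberTheory.EllipticCurves
  Literature.NumberTheory.EllipticCurves.Rank1Residual
  Literature.NumberTheory.EllipticCurves.Rank1Residual.Typed
  Literature.NumberTheory.EllipticCurves.HeathBrown1994
  Literature.NumberTheory.EllipticCurves.Tian2014
  Literature.NumberTheory.EllipticCurves.TianYuanZhang2017
  Literature.NumberTheory.EllipticCurves.TianYuanZhang2017.W2
  Literature.NumberTheory.QuadraticFields.RedeiReichardt

set_option autoImplicit false

namespace Summit.BirchSwinnertonDyer.Rank1Residual.P2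

namespace ThetaDescent

/-! ## §1 The configuration of the type `(3, 7, 7)` -/

section Cfg

variable {p₁ p₂ p₃ : ℕ}

/-- The prime triple of the type `(3, 7, 7)`: primes, none `2`, injective. [cite: HardyWright2008, §1.3 Thm. 2] -/
theorem triple_377 (hp₁ : p₁.Prime) (hp₂ : p₂.Prime) (hp₃ : p₃.Prime) (h₁ : p₁ % 8 = 3) (h₂ : p₂ % 8 = 7)
    (h₃ : p₃ % 8 = 7) (h23 : p₂ ≠ p₃) :
    (∀ i, ((![p₁, p₂, p₃] : Fin 3 → ℕ) i).Prime) ∧ (∀ i, (![p₁, p₂, p₃] : Fin 3 → ℕ) i ≠ 2) ∧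
      Function.Injective (![p₁, p₂, p₃] : Fin 3 → ℕ) := by
  have h12 : p₁ ≠ p₂ := fun h => by omega
  have h13 : p₁ ≠ p₃ := fun h => by omega
  refine ⟨fun i => by fin_cases i <;> assumption, fun i => by fin_cases i <;> simp <;> omega, ?_⟩
  intro i j h
  fin_cases i <;> fin_cases j <;> simp_all

/-- **The Legendre configuration of the type `(3, 7, 7)`**: residues `(3, 7, 7)`, bits `betaOf (3,7,7) (s₀, s₁, s₂)` with
`s₀ = [(p₂/p₁) = −1]`, `s₁ = [(p₃/p₁) = −1]`, `s₂ = [(p₃/p₂) = −1]` (transposed bits flipped: all three primes are `≡ 3 (mod 4)`).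
[cite: IrelandRosen1990, Ch. 5 §2 Thm. 1 (quadratic reciprocity)] -/
theorem cfg_377 (hp₁ : p₁.Prime) (hp₂ : p₂.Prime) (hp₃ : p₃.Prime) (h₁ : p₁ % 8 = 3) (h₂ : p₂ % 8 = 7)
    (h₃ : p₃ % 8 = 7) (h23 : p₂ ≠ p₃) :
    (fun i => (![p₁, p₂, p₃] : Fin 3 → ℕ) i % 8) = ![3, 7, 7] ∧
    (fun a b => kroneckerBit ((![p₁, p₂, p₃] : Fin 3 → ℕ) b) ((![p₁, p₂, p₃] : Fin 3 → ℕ) a)) =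
      betaOf ![3, 7, 7] ![kroneckerBit p₂ p₁, kroneckerBit p₃ p₁, kroneckerBit p₃ p₂] := by
  have hp₁2 : p₁ ≠ 2 := by omega
  have hp₂2 : p₂ ≠ 2 := by omega
  have hp₃2 : p₃ ≠ 2 := by omega
  have h12 : p₁ ≠ p₂ := fun h => by omega
  have h13 : p₁ ≠ p₃ := fun h => by omega
  have h14 : p₁ % 4 = 3 := by omega
  have h24 : p₂ % 4 = 3 := by omega
  have h34 : p₃ % 4 = 3 := by omega
  refine ⟨?_, ?_⟩
  · funext i; fin_cases i <;> simp [h₁, h₂, h₃]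
  · funext a b
    fin_cases a <;> fin_cases b
    · simpa [betaOf] using kroneckerBit_self hp₁
    · simp [betaOf]
    · simp [betaOf]
    · simp [betaOf, kroneckerBit_swap hp₁ hp₂ hp₁2 hp₂2 h12, chi4Bit, h14, h24]
    · simpa [betaOf] using kroneckerBit_self hp₂
    · simp [betaOf]
    · simp [betaOf, kroneckerBit_swap hp₁ hp₃ hp₁2 hp₃2 h13, chi4Bit, h14, h34]
    · simp [betaOf, kroneckerBit_swap hp₂ hp₃ hp₂2 hp₃2 h23, chi4Bit, h24, h34]
    · simpa [betaOf] using kroneckerBit_self hp₃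

end Cfg

/-! ## §2 The finite checks (`decide`) -/

/-- Monsky's even matrix on the type `(3, 7, 7)` has a `2`-element kernel unless `s₀ = s₁ = 1` (`s(n) = 1` on six of the eight bit
patterns; `s(n) = 3` on the other two). [cite: HeathBrown1994SelmerCongruentII, Appendix (Monsky), typescript p. 41 L20–L36] -/
theorem card_ker_monskyCfgEven_377 : ∀ s₀ s₁ s₂ : ZMod 2, s₀ * s₁ = 0 →
    Fintype.card {v : Fin 3 ⊕ Fin 3 → ZMod 2 //
      monskyCfgEven ![3, 7, 7] (betaOf ![3, 7, 7] ![s₀, s₁, s₂]) *ᵥ v = 0} = 2 := by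
  decide

/-- The Rédei bit of `ℚ(√−2p₁p₂p₃)` on the type `(3, 7, 7)`: `g(n)` odd iff `(s₀ + s₁)(1 + s₀ + s₂) = 1`, i.e. `s₀ ≠ s₁` and `s₂ = s₀`.
[cite: LiMa2008, Thm. 0.4 with Lemma 0.1, Def. 0.2 (p. 279)] -/
theorem gBitCfgTwo_377 : ∀ s₀ s₁ s₂ : ZMod 2,
    gBitCfgTwo ![3, 7, 7] (betaOf ![3, 7, 7] ![s₀, s₁, s₂]) = (s₀ + s₁) * (1 + s₀ + s₂) := by
  decide

/-- The Rédei bit of the even sub-block `ℚ(√−2p₁)`, `p₁ ≡ 3 (mod 8)`: `g(2p₁)` is ODD. [cite: LiMa2008, Thm. 0.4] -/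
theorem gBitTwoSub_377_zero : ∀ s₀ s₁ s₂ : ZMod 2,
    gBitTwoSub ![0] ![3, 7, 7] (betaOf ![3, 7, 7] ![s₀, s₁, s₂]) = 1 := by
  decide

/-- The Rédei bit of the odd sub-block `ℚ(√−p₂p₃)`, `p₂ ≡ p₃ ≡ 7 (mod 8)`: `g(p₂p₃)` is EVEN for every bit pattern.
[cite: LiMa2008, Thm. 0.4] -/
theorem gBitSub_377_oneTwo : ∀ s₀ s₁ s₂ : ZMod 2,
    gBitSub ![1, 2] ![3, 7, 7] (betaOf ![3, 7, 7] ![s₀, s₁, s₂]) = 0 := by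
  decide

/-- TYZ's `Σ₂′` on the type `(3, 7, 7)` VANISHES mod `2` wherever `g(n)` is odd (the genus criterion is silent on the whole `θ`-family).
[cite: TianYuanZhang2017, Thm. 1.2 (the second sum for n ≡ 6 (mod 8))] -/
theorem sigma2'CfgEven_377_silent : ∀ s₀ s₁ s₂ : ZMod 2, (s₀ + s₁) * (1 + s₀ + s₂) = 1 →
    sigma2'CfgEven ![3, 7, 7] (betaOf ![3, 7, 7] ![s₀, s₁, s₂]) = 0 := by
  decide

/-! ## §3 Transfers to the primes -/

section Transfer

variable {p₁ p₂ p₃ : ℕ}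

/-- On the type: `(p₂p₃/p₁) = −1` and `(p₃/p₂) = (p₂/p₁)` give the bit identities `s₀ + s₁ = 1`, `s₂ = s₀`, hence
`(s₀ + s₁)(1 + s₀ + s₂) = 1` and `s₀·s₁ = 0`. [cite: IrelandRosen1990, Ch. 5 §2 Thm. 1] -/
theorem bits_377_of_jacobiSym (hp₁ : p₁.Prime) (hp₂ : p₂.Prime) (hp₃ : p₃.Prime) (h₁ : p₁ % 8 = 3) (h₂ : p₂ % 8 = 7)
    (h₃ : p₃ % 8 = 7) (h23 : p₂ ≠ p₃) (hj : jacobiSym ((p₂ : ℤ) * p₃) p₁ = -1)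
    (hk : jacobiSym (p₃ : ℤ) p₂ = jacobiSym (p₂ : ℤ) p₁) :
    (kroneckerBit p₂ p₁ + kroneckerBit p₃ p₁) * (1 + kroneckerBit p₂ p₁ + kroneckerBit p₃ p₂) = 1 ∧
      kroneckerBit p₂ p₁ * kroneckerBit p₃ p₁ = 0 := by
  have hp₁2 : p₁ ≠ 2 := by omega
  have hp₂2 : p₂ ≠ 2 := by omega
  have h12 : p₁ ≠ p₂ := fun h => by omega
  have h13 : p₁ ≠ p₃ := fun h => by omega
  rw [jacobiSym.mul_left] at hj
  obtain ⟨a1, a2⟩ := kroneckerBit_of_jacobiSym hp₂ hp₁ hp₁2 h12.symm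
  obtain ⟨b1, b2⟩ := kroneckerBit_of_jacobiSym hp₃ hp₁ hp₁2 h13.symm
  obtain ⟨c1, c2⟩ := kroneckerBit_of_jacobiSym hp₃ hp₂ hp₂2 h23.symm
  rcases jacobiSym.eq_one_or_neg_one (int_gcd_prime_eq_one hp₂ hp₁ h12.symm) with ha | ha <;>
    rcases jacobiSym.eq_one_or_neg_one (int_gcd_prime_eq_one hp₃ hp₁ h13.symm) with hb | hb
  · rw [ha, hb] at hj; norm_num at hj
  · rw [ha] at hk; rw [a1 ha, b2 hb, c1 hk]; decide
  · rw [ha] at hk; rw [a2 ha, b1 hb, c2 hk]; decide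
  · rw [ha, hb] at hj; norm_num at hj

/-- **Monsky's `s(2p₁p₂p₃) = 1`** on the type `(3, 7, 7)` off the pattern `s₀ = s₁ = 1` (kernel-decided).
[cite: HeathBrown1994SelmerCongruentII, Appendix (Monsky), typescript p. 41 L36] -/
theorem monskySelmerRankEven_377 (hp₁ : p₁.Prime) (hp₂ : p₂.Prime) (hp₃ : p₃.Prime) (h₁ : p₁ % 8 = 3)
    (h₂ : p₂ % 8 = 7) (h₃ : p₃ % 8 = 7) (h23 : p₂ ≠ p₃) (hs : kroneckerBit p₂ p₁ * kroneckerBit p₃ p₁ = 0) :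
    monskySelmerRankEven ![p₁, p₂, p₃] = 1 := by
  obtain ⟨ht, ht2, hinj⟩ := triple_377 hp₁ hp₂ hp₃ h₁ h₂ h₃ h23
  obtain ⟨hR, hB⟩ := cfg_377 hp₁ hp₂ hp₃ h₁ h₂ h₃ h23
  rw [monskySelmerRankEven_eq_one_iff_card_ker, card_ker_monskyMatrixEven_eq_cfg _ ht ht2 hinj]
  have hmat : monskyCfgEven (fun i => (![p₁, p₂, p₃] : Fin 3 → ℕ) i % 8)
      (fun a b => kroneckerBit ((![p₁, p₂, p₃] : Fin 3 → ℕ) b) ((![p₁, p₂, p₃] : Fin 3 → ℕ) a)) =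
      monskyCfgEven ![3, 7, 7] (betaOf ![3, 7, 7] ![kroneckerBit p₂ p₁, kroneckerBit p₃ p₁, kroneckerBit p₃ p₂]) := by
    rw [hR, hB]
  rw [Fintype.card_congr (Equiv.subtypeEquivRight fun v => by rw [hmat])]
  exact card_ker_monskyCfgEven_377 _ _ _ hs

/-- **`g(2p₁p₂p₃)` odd ⟺ `(s₀ + s₁)(1 + s₀ + s₂) = 1`** on the type `(3, 7, 7)` (RR instantiated). [cite: LiMa2008, Thm. 0.4]
[cite: TianYuanZhang2017, §1 (p0002 L78–L82: g(d))] -/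
theorem odd_gK_two_mul_377_iff_bits (hp₁ : p₁.Prime) (hp₂ : p₂.Prime) (hp₃ : p₃.Prime) (h₁ : p₁ % 8 = 3)
    (h₂ : p₂ % 8 = 7) (h₃ : p₃ % 8 = 7) (h23 : p₂ ≠ p₃) :
    Odd (gK (2 * (p₁ * p₂ * p₃))) ↔
      (kroneckerBit p₂ p₁ + kroneckerBit p₃ p₁) * (1 + kroneckerBit p₂ p₁ + kroneckerBit p₃ p₂) = 1 := by
  obtain ⟨ht, ht2, hinj⟩ := triple_377 hp₁ hp₂ hp₃ h₁ h₂ h₃ h23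
  obtain ⟨hR, hB⟩ := cfg_377 hp₁ hp₂ hp₃ h₁ h₂ h₃ h23
  have hprod : 2 * ∏ i, (![p₁, p₂, p₃] : Fin 3 → ℕ) i = 2 * (p₁ * p₂ * p₃) := by rw [Fin.prod_univ_three]; rfl
  have h := natCast_genusClassNumber_two_mul_eq_gBitCfgTwo redeiReichardt_fourTwoCard_classGroup_holds _ ht ht2 hinj
  rw [hprod, hR, hB, gBitCfgTwo_377] at h
  unfold gK
  rw [← ZMod.natCast_eq_one_iff_odd, h]

/-- **`g(2p₁)` is ODD** (`p₁ ≡ 3 (mod 8)`; read through the type's configuration, RR instantiated). [cite: LiMa2008, Thm. 0.4] -/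
theorem odd_gK_two_mul_of_377 (hp₁ : p₁.Prime) (hp₂ : p₂.Prime) (hp₃ : p₃.Prime) (h₁ : p₁ % 8 = 3) (h₂ : p₂ % 8 = 7)
    (h₃ : p₃ % 8 = 7) (h23 : p₂ ≠ p₃) : Odd (gK (2 * p₁)) := by
  obtain ⟨ht, ht2, hinj⟩ := triple_377 hp₁ hp₂ hp₃ h₁ h₂ h₃ h23
  obtain ⟨hR, hB⟩ := cfg_377 hp₁ hp₂ hp₃ h₁ h₂ h₃ h23
  have h := natCast_genusClassNumber_two_mul_eq_gBitTwoSub redeiReichardt_fourTwoCard_classGroup_holds _ ht ht2 hinj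
    (![0] : Fin 1 → Fin 3) (fun i j h => by fin_cases i; fin_cases j; rfl)
  have hprod : 2 * ∏ i : Fin 1, (![p₁, p₂, p₃] : Fin 3 → ℕ) ((![0] : Fin 1 → Fin 3) i) = 2 * p₁ := by
    rw [Fin.prod_univ_one]; rfl
  rw [hprod, hR, hB, gBitTwoSub_377_zero] at h
  unfold gK
  rw [← ZMod.natCast_eq_one_iff_odd, h]

/-- **`g(p₂p₃)` is EVEN** (`p₂ ≡ p₃ ≡ 7 (mod 8)`; read through the type's configuration, RR instantiated). [cite: LiMa2008, Thm. 0.4] -/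
theorem not_odd_gK_mul_of_377 (hp₁ : p₁.Prime) (hp₂ : p₂.Prime) (hp₃ : p₃.Prime) (h₁ : p₁ % 8 = 3) (h₂ : p₂ % 8 = 7)
    (h₃ : p₃ % 8 = 7) (h23 : p₂ ≠ p₃) : ¬ Odd (gK (p₂ * p₃)) := by
  obtain ⟨ht, ht2, hinj⟩ := triple_377 hp₁ hp₂ hp₃ h₁ h₂ h₃ h23
  obtain ⟨hR, hB⟩ := cfg_377 hp₁ hp₂ hp₃ h₁ h₂ h₃ h23
  have h := natCast_genusClassNumber_eq_gBitSub redeiReichardt_fourTwoCard_classGroup_holds _ ht ht2 hinj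
    (![1, 2] : Fin 2 → Fin 3) (fun i j h => by fin_cases i <;> fin_cases j <;> simp_all)
  have hprod : ∏ i : Fin 2, (![p₁, p₂, p₃] : Fin 3 → ℕ) ((![1, 2] : Fin 2 → Fin 3) i) = p₂ * p₃ := by
    rw [Fin.prod_univ_two]; rfl
  rw [hprod, hR, hB, gBitSub_377_oneTwo] at h
  unfold gK
  rw [← ZMod.natCast_eq_one_iff_odd, h]
  exact zero_ne_one

/-- **`𝓛(p₂p₃)` is EVEN, for ANY sign choice**, from TYZ Thm. 1.1 (`h11`, the named fact `thm11_parity_of_scriptL`: `p₂p₃ ≡ 1 (mod 8)`,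
`𝓛(p₂p₃) ≡ Σ₁(p₂p₃) = g(p₂p₃) (mod 2)`, `genusSum₁_prime_mul`) and `g(p₂p₃)` even; two integers with the same square have the same parity.
CONDITIONAL on `h11`. [cite: TianYuanZhang2017, Thm. 1.1 (p0002 L90–L99)] -/
theorem even_of_isScriptL_mul_377 (h11 : thm11_parity_of_scriptL) (hp₁ : p₁.Prime) (hp₂ : p₂.Prime) (hp₃ : p₃.Prime)
    (h₁ : p₁ % 8 = 3) (h₂ : p₂ % 8 = 7) (h₃ : p₃ % 8 = 7) (h23 : p₂ ≠ p₃) {L : ℤ} (hL : IsScriptL (p₂ * p₃) L) :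
    Even L := by
  have h23m : (p₂ * p₃) % 8 = 1 := by rw [Nat.mul_mod, h₂, h₃]
  have hsq : Squarefree (p₂ * p₃) := by
    rw [Nat.squarefree_mul ((Nat.coprime_primes hp₂ hp₃).mpr h23)]
    exact ⟨hp₂.squarefree, hp₃.squarefree⟩
  obtain ⟨L', hL', hpar⟩ := h11 (p₂ * p₃) hsq (Or.inl h23m) GenusField (isGenusFieldFamily_genusField _)
  rw [genusSum₁_prime_mul hp₂ hp₃ h23 (by omega) (by omega)] at hpar
  have hg0 : ((genusClassNumber (GenusField (p₂ * p₃)) : ℕ) : ZMod 2) = 0 := by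
    rcases Nat.even_or_odd (genusClassNumber (GenusField (p₂ * p₃))) with he | ho
    · exact (ZMod.natCast_eq_zero_iff_even.mpr he)
    · exact absurd ho (not_odd_gK_mul_of_377 hp₁ hp₂ hp₃ h₁ h₂ h₃ h23)
  rw [hg0] at hpar
  have hL'even : Even L' := (ZMod.intCast_eq_zero_iff_even.mp hpar)
  -- `L² = L'²`
  have hsq' : L ^ 2 = L' ^ 2 := by
    have h : ((L : ℂ)) ^ 2 = ((L' : ℂ)) ^ 2 := by rw [hL, hL']
    exact_mod_cast h
  rcases sq_eq_sq_iff_eq_or_eq_neg.mp hsq' with h | h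
  · rw [h]; exact hL'even
  · rw [h]; exact hL'even.neg

/-- **TYZ's printed `Σ₂′(2p₁p₂p₃)` is EVEN on the whole `θ`-family of the type `(3, 7, 7)`** (`(p₂p₃/p₁) = −1`, `(p₃/p₂) = (p₂/p₁)`):
Theorem 1.2 / the U⁺ door are silent exactly where this file's family theorem speaks. Unconditional (RR instantiated).
[cite: TianYuanZhang2017, Thm. 1.2 (the second sum for n ≡ 6 (mod 8))] [cite: LiMa2008, Thm. 0.4] -/
theorem not_odd_genusSum₂'_two_mul_377 (hp₁ : p₁.Prime) (hp₂ : p₂.Prime) (hp₃ : p₃.Prime) (h₁ : p₁ % 8 = 3)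
    (h₂ : p₂ % 8 = 7) (h₃ : p₃ % 8 = 7) (h23 : p₂ ≠ p₃) (hj : jacobiSym ((p₂ : ℤ) * p₃) p₁ = -1)
    (hk : jacobiSym (p₃ : ℤ) p₂ = jacobiSym (p₂ : ℤ) p₁) :
    ¬ Odd (genusSum₂' (2 * (p₁ * p₂ * p₃)) fun d => genusClassNumber (GenusField d)) := by
  obtain ⟨ht, ht2, hinj⟩ := triple_377 hp₁ hp₂ hp₃ h₁ h₂ h₃ h23
  obtain ⟨hR, hB⟩ := cfg_377 hp₁ hp₂ hp₃ h₁ h₂ h₃ h23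
  have hprod : 2 * ∏ i, (![p₁, p₂, p₃] : Fin 3 → ℕ) i = 2 * (p₁ * p₂ * p₃) := by rw [Fin.prod_univ_three]; rfl
  have h12m : (p₁ * p₂) % 8 = 5 := by rw [Nat.mul_mod, h₁, h₂]
  have hm3 : (p₁ * p₂ * p₃) % 8 = 3 := by rw [Nat.mul_mod, h12m, h₃]
  have h8 : (2 * ∏ i, (![p₁, p₂, p₃] : Fin 3 → ℕ) i) % 8 = 6 := by rw [hprod]; omega
  have h := natCast_genusSum₂'_two_mul_three_eq_cfg _ redeiReichardt_fourTwoCard_classGroup_holds ht ht2 hinj h8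
  rw [hprod, hR, hB, sigma2'CfgEven_377_silent _ _ _ (bits_377_of_jacobiSym hp₁ hp₂ hp₃ h₁ h₂ h₃ h23 hj hk).1] at h
  rw [← ZMod.natCast_eq_one_iff_odd, h]
  exact zero_ne_one

end Transfer

/-! ## §4 THEOREM B₃ for the type `(3, 7, 7)` and the family theorems -/

section Family

variable {p₁ p₂ p₃ : ℕ}

/-- **THEOREM B₃ (type `(3, 7, 7)`)**: for TYZ data `D` at `n = 2p₁p₂p₃` with `D.Printed ∧ D.CMPointGaloisPrinted`, rank `≤ 1` once
`𝓛(n) ≠ 0`, and TYZ Thm. 1.1 (`h11`): `g(n)` odd ⟹ `𝓛(n)` odd (`g(2p₁)` odd, `𝓛(p₂p₃)` even, then the raw theorem). CONDITIONAL; nothing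
asserted. [cite: TianYuanZhang2017, Thm. 1.1, Thm. 3.5, Thm. 3.6 (2), Lemma 3.18, §3.1, proof of Lemma 3.21 (J759)] [cite: LiMa2008, Thm. 0.4] -/
theorem odd_scriptL_two_mul_377 (h11 : thm11_parity_of_scriptL) (hp₁ : p₁.Prime) (hp₂ : p₂.Prime) (hp₃ : p₃.Prime)
    (h₁ : p₁ % 8 = 3) (h₂ : p₂ % 8 = 7) (h₃ : p₃ % 8 = 7) (h23 : p₂ ≠ p₃) (D : GenusPointData (2 * (p₁ * p₂ * p₃)))
    (hD : D.Printed) (hG : D.CMPointGaloisPrinted)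
    (hr :
      letI := isElliptic_congruentNumberCurve (squarefree_two_mul_377 hp₁ hp₂ hp₃ h₁ h₂ h₃ h23).ne_zero
      D.scriptL (2 * (p₁ * p₂ * p₃)) ≠ 0 → (congruentNumberCurve (2 * (p₁ * p₂ * p₃))).mordellWeilRank ≤ 1)
    (hg : Odd (gK (2 * (p₁ * p₂ * p₃)))) : Odd (D.scriptL (2 * (p₁ * p₂ * p₃))) := by
  have hn0 : 2 * (p₁ * p₂ * p₃) ≠ 0 := (squarefree_two_mul_377 hp₁ hp₂ hp₃ h₁ h₂ h₃ h23).ne_zero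
  have h23n : p₂ * p₃ ∈ (2 * (p₁ * p₂ * p₃)).divisors := Nat.mem_divisors.mpr ⟨Dvd.intro (2 * p₁) (by ring), hn0⟩
  have hL23 : IsScriptL (p₂ * p₃) (D.scriptL (p₂ * p₃)) :=
    hD.1 _ h23n (by have := Nat.mul_le_mul hp₂.two_le hp₃.two_le; omega)
  have he : Even (D.scriptL (p₂ * p₃) * (gK (2 * p₁) : ℤ)) :=
    (even_of_isScriptL_mul_377 h11 hp₁ hp₂ hp₃ h₁ h₂ h₃ h23 hL23).mul_right _
  exact odd_scriptL_two_mul_377_raw hp₁ hp₂ hp₃ h₁ h₂ h₃ h23 D hD hG hr (((Int.odd_coe_nat _).mpr hg).sub_even he)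

/-- **`𝓛(n) ≠ 0` for the type `(3, 7, 7)` with `g(n)` odd — no rank input** (the rank hypothesis is vacuous when `𝓛(n) = 0`).
[cite: TianYuanZhang2017, Thm. 3.5 (p0011 L94–L95), Lemma 3.18] -/
theorem scriptL_ne_zero_two_mul_377 (h11 : thm11_parity_of_scriptL) (hp₁ : p₁.Prime) (hp₂ : p₂.Prime) (hp₃ : p₃.Prime)
    (h₁ : p₁ % 8 = 3) (h₂ : p₂ % 8 = 7) (h₃ : p₃ % 8 = 7) (h23 : p₂ ≠ p₃) (D : GenusPointData (2 * (p₁ * p₂ * p₃)))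
    (hD : D.Printed) (hG : D.CMPointGaloisPrinted) (hg : Odd (gK (2 * (p₁ * p₂ * p₃)))) :
    D.scriptL (2 * (p₁ * p₂ * p₃)) ≠ 0 := by
  intro h0
  have h := odd_scriptL_two_mul_377 h11 hp₁ hp₂ hp₃ h₁ h₂ h₃ h23 D hD hG (fun h => absurd h0 h) hg
  rw [h0] at h
  exact (Int.not_odd_iff_even.mpr (Even.zero)) h

/-- **Clause (a) on the explicit family of the type `(3, 7, 7)`**: for primes `p₁ ≡ 3`, `p₂ ≡ p₃ ≡ 7 (mod 8)`, `p₂ ≠ p₃`, with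
`(p₂p₃/p₁) = −1` and `(p₃/p₂) = (p₂/p₁)`: `ord_{s=1} L(E_{2p₁p₂p₃}, s) = 1`, relative to {`tyz_cmPointGaloisData`, TYZ Thm. 1.1} — no GZK,
no Selmer input, and TYZ's `Σ₂′` is EVEN on the whole family (`not_odd_genusSum₂'_two_mul_377`). CONDITIONAL; nothing asserted.
[cite: TianYuanZhang2017, Thm. 1.1, §1 (definition of 𝓛(n)), §3] -/
theorem analyticRank_eq_one_two_mul_377_family (hCM : tyz_cmPointGaloisData) (h11 : thm11_parity_of_scriptL) :
    ∀ p₁ p₂ p₃ : ℕ, p₁.Prime → p₂.Prime → p₃.Prime → p₁ % 8 = 3 → p₂ % 8 = 7 → p₃ % 8 = 7 → p₂ ≠ p₃ →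
      jacobiSym ((p₂ : ℤ) * p₃) p₁ = -1 → jacobiSym (p₃ : ℤ) p₂ = jacobiSym (p₂ : ℤ) p₁ →
      (congruentNumberCurve (2 * (p₁ * p₂ * p₃))).analyticRank = 1 := by
  intro p₁ p₂ p₃ hp₁ hp₂ hp₃ h₁ h₂ h₃ h23 hj hk
  have hsq := squarefree_two_mul_377 hp₁ hp₂ hp₃ h₁ h₂ h₃ h23
  have h12m : (p₁ * p₂) % 8 = 5 := by rw [Nat.mul_mod, h₁, h₂]
  have hm3 : (p₁ * p₂ * p₃) % 8 = 3 := by rw [Nat.mul_mod, h12m, h₃]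
  have hn6 : (2 * (p₁ * p₂ * p₃)) % 8 = 6 := by omega
  have hg : Odd (gK (2 * (p₁ * p₂ * p₃))) :=
    (odd_gK_two_mul_377_iff_bits hp₁ hp₂ hp₃ h₁ h₂ h₃ h23).mpr (bits_377_of_jacobiSym hp₁ hp₂ hp₃ h₁ h₂ h₃ h23 hj hk).1
  obtain ⟨D, hD, hG⟩ := hCM _ hsq (Or.inr (Or.inl hn6))
  have hL : IsScriptL _ (D.scriptL (2 * (p₁ * p₂ * p₃))) := hD.1 _ (Nat.mem_divisors_self _ hsq.ne_zero) (by omega)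
  exact analyticRank_congruentNumberCurve_eq_one_of_isScriptL hsq (Or.inr (Or.inl hn6)) hL
    (scriptL_ne_zero_two_mul_377 h11 hp₁ hp₂ hp₃ h₁ h₂ h₃ h23 D hD hG hg)

/-- **Monsky's C-P2-2 at `k = 3` on the explicit SILENT family of the type `(3, 7, 7)` — `ord_{s=1} L = 1`, rank `1`, `Ш[2^∞] = 0`,
`BSD(E_n, 2)`** for `n = 2p₁p₂p₃`, primes `p₁ ≡ 3`, `p₂ ≡ p₃ ≡ 7 (mod 8)`, `p₂ ≠ p₃`, `(p₂p₃/p₁) = −1`, `(p₃/p₂) = (p₂/p₁)`, relative to FOUR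
named facts: `tyz_cmPointGaloisData`, TYZ Thm. 1.1 (`thm11_parity_of_scriptL`), GZK, Monsky's even matrix theorem (`s(n) = 1` itself is
kernel-decided). CONDITIONAL; nothing asserted; closes no class by itself (smallest members `966`, `4774`).
[cite: TianYuanZhang2017, Thm. 1.1, §1 (1.1), Thm. 3.5, §3] [cite: HeathBrown1994SelmerCongruentII, Appendix (Monsky), typescript p. 41 L20–L36]
[cite: Miller2011LMS, Def. 1.1 (arXiv:1010.2431 p. 3)] -/
theorem rankOne_sha_bsdp_two_two_mul_377_family (hCM : tyz_cmPointGaloisData) (h11 : thm11_parity_of_scriptL)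
    (hGZK : rank_eq_analyticRank_of_analyticRank_le_one) (hMe : monsky_card_selmerGroup_two_even) :
    ∀ p₁ p₂ p₃ : ℕ, p₁.Prime → p₂.Prime → p₃.Prime → p₁ % 8 = 3 → p₂ % 8 = 7 → p₃ % 8 = 7 → p₂ ≠ p₃ →
      jacobiSym ((p₂ : ℤ) * p₃) p₁ = -1 → jacobiSym (p₃ : ℤ) p₂ = jacobiSym (p₂ : ℤ) p₁ →
      (congruentNumberCurve (2 * (p₁ * p₂ * p₃))).analyticRank = 1 ∧
        (congruentNumberCurve (2 * (p₁ * p₂ * p₃))).mordellWeilRank = 1 ∧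
        AddCommGroup.primaryComponent (congruentNumberCurve (2 * (p₁ * p₂ * p₃))).sha 2 = ⊥ ∧
        BSDp (congruentNumberCurve (2 * (p₁ * p₂ * p₃))) 2 := by
  intro p₁ p₂ p₃ hp₁ hp₂ hp₃ h₁ h₂ h₃ h23 hj hk
  have hsq := squarefree_two_mul_377 hp₁ hp₂ hp₃ h₁ h₂ h₃ h23
  haveI := isElliptic_congruentNumberCurve hsq.ne_zero
  have h12 : p₁ ≠ p₂ := fun h => by omega
  have h13 : p₁ ≠ p₃ := fun h => by omega
  have h12m : (p₁ * p₂) % 8 = 5 := by rw [Nat.mul_mod, h₁, h₂]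
  have hm3 : (p₁ * p₂ * p₃) % 8 = 3 := by rw [Nat.mul_mod, h12m, h₃]
  have hn6 : (2 * (p₁ * p₂ * p₃)) % 8 = 6 := by omega
  obtain ⟨hbits, hs0⟩ := bits_377_of_jacobiSym hp₁ hp₂ hp₃ h₁ h₂ h₃ h23 hj hk
  have hg : Odd (gK (2 * (p₁ * p₂ * p₃))) := (odd_gK_two_mul_377_iff_bits hp₁ hp₂ hp₃ h₁ h₂ h₃ h23).mpr hbits
  have hs : monskySelmerRankEven ![p₁, p₂, p₃] = 1 := monskySelmerRankEven_377 hp₁ hp₂ hp₃ h₁ h₂ h₃ h23 hs0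
  -- the rank-one datum `L′ = 2⁴𝓛²·Ω·Reg`
  obtain ⟨D, hD, hG⟩ := hCM _ hsq (Or.inr (Or.inl hn6))
  have hL : IsScriptL _ (D.scriptL (2 * (p₁ * p₂ * p₃))) := hD.1 _ (Nat.mem_divisors_self _ hsq.ne_zero) (by omega)
  set L := D.scriptL (2 * (p₁ * p₂ * p₃)) with hLdef
  have hLodd : Odd L := by
    refine odd_scriptL_two_mul_377 h11 hp₁ hp₂ hp₃ h₁ h₂ h₃ h23 D hD hG (fun hL0 => ?_) hg
    have har := S4 hsq (Or.inr (Or.inl hn6)) hL hL0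
    rw [(hGZK (congruentNumberCurve _) har).1]; exact har
  have hL0' : L ≠ 0 := fun h => by simp [h] at hLodd
  have hL0 : (L : ℚ) ≠ 0 := by exact_mod_cast hL0'
  have hr1 := analyticRank_congruentNumberCurve_eq_one_of_isScriptL hsq (Or.inr (Or.inl hn6)) hL hL0'
  have ht : ∀ i, ((![p₁, p₂, p₃] : Fin 3 → ℕ) i).Prime := fun i => by fin_cases i <;> assumption
  have hodd : ∀ i, Odd ((![p₁, p₂, p₃] : Fin 3 → ℕ) i) := fun i => by
    fin_cases i <;> exact Nat.odd_iff.mpr (by simp; omega)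
  have hinj : Function.Injective (![p₁, p₂, p₃] : Fin 3 → ℕ) := by
    intro i j h
    fin_cases i <;> fin_cases j <;> simp_all
  have he : twoExponent (2 * (p₁ * p₂ * p₃)) = 4 := by
    have h := twoExponent_two_mul_prod_eq _ ht hodd hinj
    rw [Fin.prod_univ_three] at h
    norm_num at h
    exact h
  have hx : deriv (congruentNumberCurve (2 * (p₁ * p₂ * p₃))).entireLFunction 1 =
      (((2 : ℚ) ^ twoExponent (2 * (p₁ * p₂ * p₃)) * (L : ℚ) ^ 2 : ℚ) : ℂ) *
        ((congruentNumberCurve (2 * (p₁ * p₂ * p₃))).realPeriodRat : ℂ) *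
          ((congruentNumberCurve (2 * (p₁ * p₂ * p₃))).regulator : ℂ) := by
    rw [← (leadingLCoeff_eq_deriv_of_analyticRank_eq_one hr1).1,
      leadingLCoeff_congruentNumberCurve_eq_of_isScriptL (Nat.pos_of_ne_zero hsq.ne_zero) hr1 hL]
    push_cast
    ring
  have hx0 : (2 : ℚ) ^ twoExponent (2 * (p₁ * p₂ * p₃)) * (L : ℚ) ^ 2 ≠ 0 :=
    mul_ne_zero (zpow_ne_zero _ two_ne_zero) (pow_ne_zero _ hL0)
  obtain ⟨hr1', hrk, hsha, hiff⟩ :=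
    rankOne_sha_bsdp_two_iff_congruentNumberCurve_two_mul_pqr hGZK hMe hp₁ hp₂ hp₃ h12 h13 h23 hn6 hs hx0 hx
  refine ⟨hr1', hrk, hsha, hiff.mpr ?_⟩
  rw [padicValRat_two_zpow_mul_sq hLodd, he]

end Family

end ThetaDescent

end Summit.BirchSwinnertonDyer.Rank1Residual.P2

end
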